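import Literature.NumberTheory.Automorphic.GL2ParabolicKernelBorel
import Literature.NumberTheory.Automorphic.IwasawaHaarGL2
import HarnessLib

/-!
# The Borel sum at `y = k d(a) n(x)`: `y (d(μ) n(ν)) y⁻¹ = k d(μ) n(λ(ν - c_μ x)) k⁻¹` and
# `‖Σ_{β ∈ B(K) ∖ Z} G(β)‖ ≤ Σ_μ ‖Σ_ν Ĝ(μ, ν)‖ + Σ_ζ ‖Ĝ((ζ, ζ), 0)‖`
(Gelbart, *Automorphic forms on adele groups* (1975), §9.B, (9.40)–(9.43) and the proof of
Lemma 9.13: `f(x⁻¹ μ ν x)` with `x = v h_t k`, "`Σ_{μ ∈ A_ℚ} Σ_{ν ∈ N_ℚ}`", the central terms `μ ∈ Z_ℚ`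
separated in (9.43))

Topic `NumberTheory/Automorphic`; one definition with body (`GL2.borelParamEquiv`, the coordinates
`(μ₁, μ₂, ν) ↦ d(μ₁, μ₂) n(ν)` on the Borel subgroup of `GL₂` over a field) and theorems:

* `GL2.unipotentGL2_conj_borel`, `GL2.diagGL2_conj_borel`, `GL2.kan_conj_borel` — **the conjugation
  formula** `(k d(a₁,a₂) n(x)) · (d(p₁,p₂) n(q)) · (k d(a₁,a₂) n(x))⁻¹ =
  k · d(p₁,p₂) n(a₁ a₂⁻¹ (q - (1 - p₂ p₁⁻¹) x)) · k⁻¹` in `GL₂` over any commutative ring: conjugating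
  a Borel element by a point of the box in Iwasawa coordinates `K · A · N` dilates the unipotent
  coordinate by the simple root `λ = a₁/a₂` and shifts it by `c_μ x`, `c_μ = 1 - p₂/p₁`
  (Gelbart's `v⁻¹ h_t⁻¹ μ ν h_t v`).
* `GL2.borelParamEquiv` (**definition**), `GL2.coe_borelParamEquiv`,
  `GL2.borelParamEquiv_mem_center_iff` — `(Fˣ × Fˣ) × F ≃ B(F)`, central iff `μ₁ = μ₂ ∧ ν = 0`;
  `GL2.borelNoncentralEquiv` — the induced bijection of `{β ∈ B(F) : β ∉ Z}` with the non-central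
  parameters.
* `GL2.tsum_borel_noncentral_eq` — for a summable `Ĝ` on the parameters,
  `Σ'_{β ∈ B ∖ Z} Ĝ(β) = Σ'_μ Σ'_ν Ĝ(μ, ν) - Σ'_ζ Ĝ((ζ, ζ), 0)`;
  `GL2.enorm_tsum_borel_noncentral_le` — **`‖Σ'_{β ∈ B ∖ Z} Ĝ(β)‖ₑ ≤ Σ'_μ ‖Σ'_ν Ĝ(μ, ν)‖ₑ +
  Σ'_ζ ‖Ĝ((ζ, ζ), 0)‖ₑ`** (the shape in which Poisson summation in `ν` is applied `μ` by `μ`, the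
  central terms being bounded separately, Gelbart (9.43)).

Part of the inline (D-0026) decomposition of
`Literature.NumberTheory.Automorphic.jacquetLanglands_transfer_exists` (the `J`-part of the
parabolic term of the `GL₂` trace formula, with `GL2ParabolicKernelBorel`, `GL2BorelCoveringBox`,
`AdelicPoissonScaled`).

## References

* S. Gelbart, *Automorphic forms on adele groups*, Ann. of Math. Studies 83 (1975), (9.40)–(9.43),
  Lemma 9.13 [Gelbart1975].
-/

noncomputable section

open Matrix Set
open scoped MatrixGroups NNReal ENNReal

namespace Literature.NumberTheory.Automorphic

/-! ### The conjugation formula -/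

section Algebra

variable {R : Type*} [CommRing R]

/-- `n(x)⁻¹ = n(-x)`. [folklore] -/
theorem unipotentGL2_inv_eq_neg (x : R) :
    (unipotentGL2 x : ↥(upperUnitriangular (Fin 2) R))⁻¹ = unipotentGL2 (-x) := by
  rw [inv_eq_iff_mul_eq_one, ← unipotentGL2_add, add_neg_cancel, unipotentGL2_zero]

/-- **`d(a₁,a₂) n(w) d(a₁,a₂)⁻¹ = n(a₁ w a₂⁻¹)`**: the torus dilates the unipotent radical by the simple
root. [folklore] -/
theorem GL2.diagGL2_conj_unipotentGL2 (a₁ a₂ : Rˣ) (w : R) :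
    diagGL2 a₁ a₂ * ((unipotentGL2 w : ↥(upperUnitriangular (Fin 2) R)) : GL (Fin 2) R) *
        (diagGL2 a₁ a₂)⁻¹ =
      ((unipotentGL2 ((a₁ : R) * w * ((a₂⁻¹ : Rˣ) : R)) : ↥(upperUnitriangular (Fin 2) R)) :
        GL (Fin 2) R) := by
  have h := diagGL2_inv_mul_unipotentGL2_mul_diagGL2 a₁⁻¹ a₂⁻¹ w
  rw [diagGL2_inv, inv_inv, inv_inv] at h
  rw [diagGL2_inv]
  exact h

/-- **`n(x) · d(p₁,p₂) n(q) · n(x)⁻¹ = d(p₁,p₂) n(q - (1 - p₂ p₁⁻¹) x)`**: conjugating a Borel element by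
a unipotent shifts its unipotent coordinate. [cite: Gelbart1975, (9.40)–(9.42)] -/
theorem GL2.unipotentGL2_conj_borel (x : R) (p₁ p₂ : Rˣ) (q : R) :
    ((unipotentGL2 x : ↥(upperUnitriangular (Fin 2) R)) : GL (Fin 2) R) *
        (diagGL2 p₁ p₂ * ((unipotentGL2 q : ↥(upperUnitriangular (Fin 2) R)) : GL (Fin 2) R)) *
        (((unipotentGL2 x : ↥(upperUnitriangular (Fin 2) R)) : GL (Fin 2) R))⁻¹ =
      diagGL2 p₁ p₂ * ((unipotentGL2 (q - (1 - (p₂ : R) * ((p₁⁻¹ : Rˣ) : R)) * x) :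
        ↥(upperUnitriangular (Fin 2) R)) : GL (Fin 2) R) := by
  -- `n(x) d(p) = d(p) n(p₁⁻¹ x p₂)`
  have h1 : ((unipotentGL2 x : ↥(upperUnitriangular (Fin 2) R)) : GL (Fin 2) R) * diagGL2 p₁ p₂ =
      diagGL2 p₁ p₂ * ((unipotentGL2 (((p₁⁻¹ : Rˣ) : R) * x * (p₂ : R)) :
        ↥(upperUnitriangular (Fin 2) R)) : GL (Fin 2) R) := by
    rw [← diagGL2_inv_mul_unipotentGL2_mul_diagGL2, ← mul_assoc, ← mul_assoc, mul_inv_cancel,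
      one_mul]
  rw [← Subgroup.coe_inv, unipotentGL2_inv_eq_neg, ← mul_assoc, h1, mul_assoc,
    mul_assoc, ← Subgroup.coe_mul, ← Subgroup.coe_mul, ← unipotentGL2_add, ← unipotentGL2_add]
  congr 3
  ring

/-- **`d(a₁,a₂) · d(p₁,p₂) n(w) · d(a₁,a₂)⁻¹ = d(p₁,p₂) n(a₁ w a₂⁻¹)`**: conjugating by the torus
dilates the unipotent coordinate by the simple root. [cite: Gelbart1975, (9.40)–(9.42)] -/
theorem GL2.diagGL2_conj_borel (a₁ a₂ p₁ p₂ : Rˣ) (w : R) :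
    diagGL2 a₁ a₂ * (diagGL2 p₁ p₂ * ((unipotentGL2 w : ↥(upperUnitriangular (Fin 2) R)) :
        GL (Fin 2) R)) * (diagGL2 a₁ a₂)⁻¹ =
      diagGL2 p₁ p₂ * ((unipotentGL2 ((a₁ : R) * w * ((a₂⁻¹ : Rˣ) : R)) :
        ↥(upperUnitriangular (Fin 2) R)) : GL (Fin 2) R) := by
  have hcomm : diagGL2 a₁ a₂ * diagGL2 p₁ p₂ = diagGL2 p₁ p₂ * diagGL2 a₁ a₂ := by
    rw [← diagGL2_mul, ← diagGL2_mul, mul_comm a₁, mul_comm a₂]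
  rw [← mul_assoc, hcomm, mul_assoc, mul_assoc, ← mul_assoc (diagGL2 a₁ a₂),
    GL2.diagGL2_conj_unipotentGL2]

/-- **The conjugation formula in Iwasawa coordinates `K · A · N`**:
`(k d(a₁,a₂) n(x)) · (d(p₁,p₂) n(q)) · (k d(a₁,a₂) n(x))⁻¹ = k · d(p₁,p₂) n(a₁ a₂⁻¹ (q - (1 - p₂ p₁⁻¹) x)) · k⁻¹`
(Gelbart's `x⁻¹ μ ν x` for `x = v h_t k`: dilation by the simple root, shift by `c_μ x`).
[cite: Gelbart1975, (9.40)–(9.42)] -/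
theorem GL2.kan_conj_borel (k : GL (Fin 2) R) (a₁ a₂ : Rˣ) (x : R) (p₁ p₂ : Rˣ) (q : R) :
    (k * diagGL2 a₁ a₂ * ((unipotentGL2 x : ↥(upperUnitriangular (Fin 2) R)) : GL (Fin 2) R)) *
        (diagGL2 p₁ p₂ * ((unipotentGL2 q : ↥(upperUnitriangular (Fin 2) R)) : GL (Fin 2) R)) *
        (k * diagGL2 a₁ a₂ * ((unipotentGL2 x : ↥(upperUnitriangular (Fin 2) R)) : GL (Fin 2) R))⁻¹ =
      k * (diagGL2 p₁ p₂ * ((unipotentGL2 ((a₁ : R) * (q - (1 - (p₂ : R) * ((p₁⁻¹ : Rˣ) : R)) * x) *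
        ((a₂⁻¹ : Rˣ) : R)) : ↥(upperUnitriangular (Fin 2) R)) : GL (Fin 2) R)) * k⁻¹ := by
  rw [_root_.mul_inv_rev, _root_.mul_inv_rev]
  have h1 := GL2.unipotentGL2_conj_borel x p₁ p₂ q
  have h2 := GL2.diagGL2_conj_borel a₁ a₂ p₁ p₂ (q - (1 - (p₂ : R) * ((p₁⁻¹ : Rˣ) : R)) * x)
  calc k * diagGL2 a₁ a₂ * ((unipotentGL2 x : ↥(upperUnitriangular (Fin 2) R)) : GL (Fin 2) R) *
        (diagGL2 p₁ p₂ * ((unipotentGL2 q : ↥(upperUnitriangular (Fin 2) R)) : GL (Fin 2) R)) *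
        ((((unipotentGL2 x : ↥(upperUnitriangular (Fin 2) R)) : GL (Fin 2) R))⁻¹ *
          ((diagGL2 a₁ a₂)⁻¹ * k⁻¹))
      = k * (diagGL2 a₁ a₂ * (((unipotentGL2 x : ↥(upperUnitriangular (Fin 2) R)) : GL (Fin 2) R) *
          (diagGL2 p₁ p₂ * ((unipotentGL2 q : ↥(upperUnitriangular (Fin 2) R)) : GL (Fin 2) R)) *
          (((unipotentGL2 x : ↥(upperUnitriangular (Fin 2) R)) : GL (Fin 2) R))⁻¹) *
          (diagGL2 a₁ a₂)⁻¹) * k⁻¹ := by simp only [mul_assoc]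
    _ = _ := by rw [h1, h2]

end Algebra

/-! ### Coordinates on the rational Borel subgroup -/

section Param

variable {F : Type*} [Field F]

/-- **Coordinates on `B(F)`**: `((μ₁, μ₂), ν) ↦ d(μ₁, μ₂) n(ν)`, a bijection `(Fˣ × Fˣ) × F ≃ B(F)`
(`borelCoordGL2` composed with `ν ↦ n(ν)`). [folklore] -/
def GL2.borelParamEquiv : (Fˣ × Fˣ) × F ≃ ↥(standardParabolicGL F (id : Fin 2 → Fin 2)) :=
  (Equiv.prodCongr (Equiv.refl _) (Equiv.ofBijective (unipotentGL2 (R := F))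
    ⟨unipotentGL2_injective, fun u => ⟨_, unipotentGL2_entry u⟩⟩)).trans borelCoordGL2

/-- `borelParamEquiv ((μ₁, μ₂), ν) = d(μ₁, μ₂) n(ν)` in `GL₂(F)`. [folklore] -/
@[simp]
theorem GL2.coe_borelParamEquiv (t : (Fˣ × Fˣ) × F) :
    ((GL2.borelParamEquiv t : ↥(standardParabolicGL F (id : Fin 2 → Fin 2))) : GL (Fin 2) F) =
      diagGL2 t.1.1 t.1.2 * ((unipotentGL2 t.2 : ↥(upperUnitriangular (Fin 2) F)) : GL (Fin 2) F) :=
  rfl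

/-- The entries of `d(μ₁, μ₂) n(ν)`: `(0,0) = μ₁`, `(0,1) = μ₁ ν`, `(1,1) = μ₂`. [folklore] -/
theorem GL2.coe_borelParam_apply (t : (Fˣ × Fˣ) × F) :
    ((diagGL2 t.1.1 t.1.2 * ((unipotentGL2 t.2 : ↥(upperUnitriangular (Fin 2) F)) : GL (Fin 2) F) :
      GL (Fin 2) F) : Matrix (Fin 2) (Fin 2) F) = !![(t.1.1 : F), (t.1.1 : F) * t.2; 0, (t.1.2 : F)] := by
  rw [Units.val_mul, coe_diagGL2, coe_unipotentGL2]
  ext i j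
  fin_cases i <;> fin_cases j <;> simp [Matrix.mul_apply, Fin.sum_univ_two]

/-- **`d(μ₁, μ₂) n(ν)` is central iff `μ₁ = μ₂` and `ν = 0`.** [folklore] -/
theorem GL2.borelParamEquiv_mem_center_iff (t : (Fˣ × Fˣ) × F) :
    ((GL2.borelParamEquiv t : ↥(standardParabolicGL F (id : Fin 2 → Fin 2))) : GL (Fin 2) F) ∈
        Subgroup.center (GL (Fin 2) F) ↔ t.1.1 = t.1.2 ∧ t.2 = 0 := by
  rw [GL2.mem_center_iff_of_mem_borel _ (GL2.borelParamEquiv t).2, GL2.coe_borelParamEquiv,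
    GL2.coe_borelParam_apply]
  simp only [Matrix.of_apply, Matrix.cons_val', Matrix.cons_val_zero, Matrix.cons_val_one,
    Matrix.cons_val_fin_one]
  constructor
  · rintro ⟨h1, h2⟩
    refine ⟨Units.ext h1, ?_⟩
    rcases mul_eq_zero.1 h2 with h | h
    · exact absurd h t.1.1.ne_zero
    · exact h
  · rintro ⟨h1, h2⟩
    exact ⟨congrArg Units.val h1, by rw [h2, mul_zero]⟩

/-- **The non-central Borel elements in coordinates**: `{β ∈ B(F) : β ∉ Z} ≃ {((μ₁,μ₂),ν) : ¬(μ₁ = μ₂ ∧ ν = 0)}`,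
`β = d(μ₁, μ₂) n(ν)`. [folklore] -/
def GL2.borelNoncentralEquiv :
    {t : (Fˣ × Fˣ) × F // ¬ (t.1.1 = t.1.2 ∧ t.2 = 0)} ≃
      {β : GL (Fin 2) F // β ∈ standardParabolicGL F (id : Fin 2 → Fin 2) ∧
        β ∉ Subgroup.center (GL (Fin 2) F)} :=
  ((Equiv.subtypeEquiv GL2.borelParamEquiv (fun t => by
      rw [GL2.borelParamEquiv_mem_center_iff])).trans
    (Equiv.subtypeSubtypeEquivSubtypeInter
      (fun β : GL (Fin 2) F => β ∈ standardParabolicGL F (id : Fin 2 → Fin 2))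
      (fun β => β ∉ Subgroup.center (GL (Fin 2) F)))) 

/-- Unfolding of `borelNoncentralEquiv`. [folklore] -/
@[simp]
theorem GL2.coe_borelNoncentralEquiv (t : {t : (Fˣ × Fˣ) × F // ¬ (t.1.1 = t.1.2 ∧ t.2 = 0)}) :
    ((GL2.borelNoncentralEquiv t : {β : GL (Fin 2) F // β ∈ standardParabolicGL F (id : Fin 2 → Fin 2) ∧
        β ∉ Subgroup.center (GL (Fin 2) F)}) : GL (Fin 2) F) =
      diagGL2 t.1.1.1 t.1.1.2 * ((unipotentGL2 t.1.2 : ↥(upperUnitriangular (Fin 2) F)) : GL (Fin 2) F) :=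
  rfl

/-- The central parameters `{((ζ, ζ), 0)}` in bijection with `Fˣ`. [folklore] -/
def GL2.borelCentralParamEquiv :
    Fˣ ≃ ↥({t : (Fˣ × Fˣ) × F | t.1.1 = t.1.2 ∧ t.2 = 0}) where
  toFun ζ := ⟨((ζ, ζ), 0), Set.mem_setOf_eq ▸ ⟨rfl, rfl⟩⟩
  invFun t := t.1.1.1
  left_inv ζ := rfl
  right_inv t := by
    obtain ⟨⟨⟨μ₁, μ₂⟩, ν⟩, ht⟩ := t
    obtain ⟨h1, h2⟩ := (Set.mem_setOf_eq (p := fun t : (Fˣ × Fˣ) × F => t.1.1 = t.1.2 ∧ t.2 = 0)) ▸ ht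
    simp only at h1 h2
    subst h1; subst h2
    rfl

end Param

/-! ### The Borel sum: splitting off the centre and the estimate -/

section Sum

variable {F : Type*} [Field F]

/-- **`Σ'_{β ∈ B ∖ Z} Ĝ(β) = Σ'_{(μ,ν)} Ĝ(μ, ν) - Σ'_ζ Ĝ((ζ, ζ), 0)`** for a summable `Ĝ` on the
parameters `(Fˣ × Fˣ) × F` (Gelbart (9.43): the central terms separated). [cite: Gelbart1975, (9.43)] -/
theorem GL2.tsum_borel_noncentral_eq {G : (Fˣ × Fˣ) × F → ℂ} (hG : Summable G) :
    ∑' β : {β : GL (Fin 2) F // β ∈ standardParabolicGL F (id : Fin 2 → Fin 2) ∧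
        β ∉ Subgroup.center (GL (Fin 2) F)}, G (GL2.borelParamEquiv.symm ⟨β.1, β.2.1⟩) =
      ∑' t : (Fˣ × Fˣ) × F, G t - ∑' ζ : Fˣ, G ((ζ, ζ), 0) := by
  -- reindex by the non-central parameters
  have h1 : ∑' β : {β : GL (Fin 2) F // β ∈ standardParabolicGL F (id : Fin 2 → Fin 2) ∧
      β ∉ Subgroup.center (GL (Fin 2) F)}, G (GL2.borelParamEquiv.symm ⟨β.1, β.2.1⟩) =
      ∑' t : {t : (Fˣ × Fˣ) × F // ¬ (t.1.1 = t.1.2 ∧ t.2 = 0)}, G t := by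
    rw [← (GL2.borelNoncentralEquiv (F := F)).tsum_eq]
    refine tsum_congr fun t => ?_
    congr 1
    change GL2.borelParamEquiv.symm (GL2.borelParamEquiv t.1) = t.1
    rw [Equiv.symm_apply_apply]
  -- split the parameter sum into central and non-central parts
  have h2 := hG.tsum_subtype_add_tsum_subtype_compl {t : (Fˣ × Fˣ) × F | t.1.1 = t.1.2 ∧ t.2 = 0}
  have h3 : ∑' t : ↥({t : (Fˣ × Fˣ) × F | t.1.1 = t.1.2 ∧ t.2 = 0}), G t = ∑' ζ : Fˣ, G ((ζ, ζ), 0) := by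
    rw [← (GL2.borelCentralParamEquiv (F := F)).tsum_eq]
    rfl
  have h4 : ∑' t : ↥({t : (Fˣ × Fˣ) × F | t.1.1 = t.1.2 ∧ t.2 = 0}ᶜ), G t =
      ∑' t : {t : (Fˣ × Fˣ) × F // ¬ (t.1.1 = t.1.2 ∧ t.2 = 0)}, G t := rfl
  rw [h1, ← h4, ← h3]
  exact eq_sub_of_add_eq ((add_comm _ _).trans h2)

/-- **`‖Σ'_{β ∈ B ∖ Z} Ĝ(β)‖ₑ ≤ Σ'_μ ‖Σ'_ν Ĝ(μ, ν)‖ₑ + Σ'_ζ ‖Ĝ((ζ, ζ), 0)‖ₑ`** for a summable `Ĝ` on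
the parameters: the shape in which Poisson summation in `ν` is applied for each diagonal part `μ`
and the central terms are bounded apart (Gelbart (1975), (9.43) and Lemma 9.13).
[cite: Gelbart1975, (9.43)] -/
theorem GL2.enorm_tsum_borel_noncentral_le {G : (Fˣ × Fˣ) × F → ℂ} (hG : Summable G) :
    ‖∑' β : {β : GL (Fin 2) F // β ∈ standardParabolicGL F (id : Fin 2 → Fin 2) ∧
        β ∉ Subgroup.center (GL (Fin 2) F)}, G (GL2.borelParamEquiv.symm ⟨β.1, β.2.1⟩)‖ₑ ≤
      (∑' μ : Fˣ × Fˣ, ‖∑' ν : F, G (μ, ν)‖ₑ) + ∑' ζ : Fˣ, ‖G ((ζ, ζ), 0)‖ₑ := by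
  rw [GL2.tsum_borel_noncentral_eq hG, hG.tsum_prod' (fun μ => hG.prod_factor μ)]
  exact (enorm_sub_le).trans (add_le_add enorm_tsum_le_tsum_enorm enorm_tsum_le_tsum_enorm)

/-- The diagonal embedding on the coordinates: `ι(d(μ₁, μ₂) n(ν)) = d(ι μ₁, ι μ₂) n(ι ν)` for a ring
map `ι`. [folklore] -/
theorem GL2.map_borelParam {S : Type*} [CommRing S] (f : F →+* S) (t : (Fˣ × Fˣ) × F) :
    Matrix.GeneralLinearGroup.map f
        (diagGL2 t.1.1 t.1.2 * ((unipotentGL2 t.2 : ↥(upperUnitriangular (Fin 2) F)) : GL (Fin 2) F)) =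
      diagGL2 (Units.map (f : F →* S) t.1.1) (Units.map (f : F →* S) t.1.2) *
        ((unipotentGL2 (f t.2) : ↥(upperUnitriangular (Fin 2) S)) : GL (Fin 2) S) := by
  rw [map_mul, map_diagGL2, map_unipotentGL2]

/-- **Reindexing a Borel sum by coordinates**: for `H : GL₂(F) → ℂ`,
`Σ'_{β ∈ B ∖ Z} H(β) = Σ'_{β ∈ B ∖ Z} Ĝ(coords β)` with `Ĝ(t) = H(d(μ₁,μ₂) n(ν))`. [folklore] -/
theorem GL2.tsum_borel_noncentral_congr_param (H : GL (Fin 2) F → ℂ) :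
    ∑' β : {β : GL (Fin 2) F // β ∈ standardParabolicGL F (id : Fin 2 → Fin 2) ∧
        β ∉ Subgroup.center (GL (Fin 2) F)}, H β =
      ∑' β : {β : GL (Fin 2) F // β ∈ standardParabolicGL F (id : Fin 2 → Fin 2) ∧
        β ∉ Subgroup.center (GL (Fin 2) F)},
        (fun t : (Fˣ × Fˣ) × F => H (diagGL2 t.1.1 t.1.2 *
          ((unipotentGL2 t.2 : ↥(upperUnitriangular (Fin 2) F)) : GL (Fin 2) F)))
          (GL2.borelParamEquiv.symm ⟨β.1, β.2.1⟩) := by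
  refine tsum_congr fun β => ?_
  have h : ((GL2.borelParamEquiv (GL2.borelParamEquiv.symm ⟨β.1, β.2.1⟩) :
      ↥(standardParabolicGL F (id : Fin 2 → Fin 2))) : GL (Fin 2) F) = β.1 := by
    rw [Equiv.apply_symm_apply]
  conv_lhs => rw [← h]
  rfl

end Sum

end Literature.NumberTheory.Automorphic
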